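import Summits.BirchSwinnertonDyer.Rank1Residual.Ordinary.StrictSelmerIndexLetterAtThree
import Summits.BirchSwinnertonDyer.Rank1Residual.Ordinary.PointDivisibilityFormalLevel
import HarnessLib

/-!
# `#Sel_0(ℚ, E[p^∞]) = p^(m_p) · #Ш(E/ℚ)[p^∞]` with `m_p` READ ON THE FORMAL GROUP (one evaluation of `z(#Ẽ(𝔽_p)·P₁)`), and
# `E(ℚ_p)[p] = 0` at an odd good non-anomalous `p` (theorems only — no definition, no named fact; nothing about any curve's BSD)

HONEST FRAMING (cell `b2b-bsdres`, run/shared/lean/b2b/bsd-rank1-residual/, verbatim in every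
file): the goal of the cell is to DELETE the COMBINATION-SHAPED residual classes of the
Birch–Swinnerton-Dyer formula for ALL analytic-rank `≤ 1` elliptic curves over `ℚ` — "full BSD
formula for every rank `≤ 1` curve in class `C`" assembled STRICTLY from published theorems — so
that the rank-`≤ 1` remainder becomes exactly the CONSTRUCTION-SHAPED classes, which are TYPED
(missing-input `Prop`s), NOT attempted. This is not "finishing BSD". Seat `b2b-bsdres-additive-p3`
(X8 prover B / X7 joint; typer-designate for the cell conjecture C-16 = hyp C120.1 by hyp R-16 (e)).
This file books nothing and moves no mark; X7 / X8 stay CONSTRUCTION-SHAPED.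

## What this file does

The P-5 instruments compute `m_p := v_p[E(ℚ_p) ⊗ ℤ_p : ℤ_p·P]` as «(formal-group level of `#Ẽ(𝔽_p)·P`) − 1»
(`R1-DEPTH-LAW.md` §1); `Ordinary/PointDivisibilityFormalLevel.lean` proved `P ∈ p^j E(ℚ_p) ⟺ #Ẽ(𝔽_p)·P ∈ E⁽ʲ⁺¹⁾`
at an odd good non-anomalous `p`. With the strict-Selmer count (`Ordinary/StrictSelmerIndexLetterAtThree.lean`,
`natCard_strictSelmer_rat_eq_of_padic_level`) this gives:
* `forall_nsmul_eq_zero_padic_of_not_dvd_reductionPointCount`: **`E(ℚ_p)[p] = 0`** at an odd `p ∤ Δ_min` with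
  `p ∤ #Ẽ(𝔽_p)` (AEC IV.6.1 + VII.2.1; the tree had `p = 3`);
* **`natCard_strictSelmer_rat_eq_of_formalLevel`**: for `E/ℚ` globally minimal, such a `p`, the place `v ∋ p`, `P₁` of
  infinite order generating `E(ℚ)` modulo torsion and `j` with `#Ẽ(𝔽_p)·P₁ ∈ E⁽ʲ⁺¹⁾(ℚ_p) ∖ E⁽ʲ⁺²⁾(ℚ_p)`:
  `#(Sel_{p^∞}(E/ℚ) ∩ ker(→ H¹(ℚ_v, E[p^∞]))) = p^j · #Ш(E/ℚ)[p^∞]` — the instruments' `m_p` is the `m_p` of the count.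

References: J. H. Silverman, AEC 2nd ed. (2009), IV.6.1, IV.6.4 (b), VII.2.1 [SilvermanAEC2009]; C.-H. Kim, Amer. J. Math. =
arXiv:2203.12159, §5.1 [Kim2022StructureSelmer]; `R1-DEPTH-LAW.md` §1–§2.
-/

noncomputable section

open scoped Classical
open scoped AddSubgroup

open WeierstrassCurve Literature.NumberTheory.EllipticCurves
  Literature.NumberTheory.GaloisRepresentations

universe u

namespace Summit.BirchSwinnertonDyer.Rank1Residual.Ordinary

section FormalLevel

open Rat.HeightOneSpectrum NumberField IsDedekindDomain

variable (W : WeierstrassCurve ℚ) [W.IsElliptic] [W.IsGloballyMinimal] {p : ℕ} [hp : Fact p.Prime]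
  {v : HeightOneSpectrum (𝓞 ℚ)}

omit [W.IsElliptic] in
/-- **`E(ℚ_p)[p] = 0` at an odd good non-anomalous prime `p`** (`p ∤ Δ_min`, `p ∤ #Ẽ(𝔽_p)`): a non-zero `P`
with `pP = 0` is not in `E₁(ℚ_p)` (AEC IV.6.1, `‖z(pP)‖ = p⁻¹‖z(P)‖` for `p` odd), so it reduces to a point of
order `p` of `Ẽ(𝔽_p)` (AEC VII.2.1), forcing `p ∣ #Ẽ(𝔽_p)`. (The tree's
`forall_three_nsmul_eq_zero_padic_of_frobeniusTrace_three` is the case `p = 3`.)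
[cite: SilvermanAEC2009, IV.6.1 and Prop. VII.2.1] -/
theorem forall_nsmul_eq_zero_padic_of_not_dvd_reductionPointCount (hp2 : p ≠ 2)
    (hgood : ¬ (p : ℤ) ∣ minimalDiscriminantInt W) (hna : ¬ p ∣ W.reductionPointCount p)
    (P : (W.baseChange ℚ_[p]).toAffine.Point) (hP : p • P = 0) : P = 0 := by
  by_contra hP0
  obtain ⟨r, hr⟩ := exists_reductionHom (W := W) (q := p) hgood
  have hker : ∀ Q, r Q = 0 ↔ (W.baseChange ℚ_[p]).IsInReductionKernel Q := fun Q => by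
    rw [hr Q]
    exact reducePoint_congrEquiv_eq_zero_iff hgood Q
  -- `P ∉ E₁(ℚ_p)` (AEC IV.6.1, `p` odd)
  have hnk : ¬ (W.baseChange ℚ_[p]).IsInReductionKernel P := by
    intro hk
    have key := (W.baseChange ℚ_[p]).norm_formalParameter_p_nsmul_eq (p := p) hp2 hk
    rw [hP, WeierstrassCurve.formalParameter_zero, norm_zero] at key
    have hp' : (0 : ℝ) < ((p : ℕ) : ℝ)⁻¹ := by
      have : (0 : ℝ) < (p : ℝ) := by exact_mod_cast hp.out.pos
      exact inv_pos.mpr this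
    have hz : ‖(W.baseChange ℚ_[p]).formalParameter P‖ = 0 := by
      rcases mul_eq_zero.mp key.symm with h | h
      · exact absurd h hp'.ne'
      · exact h
    exact hP0 (((W.baseChange ℚ_[p]).formalParameter_eq_zero_iff hk).mp (norm_eq_zero.mp hz))
  have hrP : r P ≠ 0 := fun h => hnk ((hker P).mp h)
  have hpr : p • r P = 0 := by rw [← map_nsmul, hP, map_zero]
  have hord : addOrderOf (r P) = p := addOrderOf_eq_prime hpr hrP
  apply hna
  have h := addOrderOf_dvd_natCard (r P)
  rwa [hord, W.natCard_point_padicModel_residue p] at h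

/-- **`#Sel_0(ℚ, E[p^∞]) = p^j · #Ш(E/ℚ)[p^∞]` with `m_p` READ ON THE FORMAL GROUP** — the P-5 instruments' recipe
«`m_p` = (formal level of `#Ẽ(𝔽_p)·P₁`) − 1» made a theorem: for `E/ℚ` globally minimal, an odd good non-anomalous
prime `p` (`p ∤ Δ_min`, `p ∤ #Ẽ(𝔽_p)`), the place `v ∋ p`, `P₁` of infinite order generating `E(ℚ)` modulo torsion,
and `j` with `#Ẽ(𝔽_p)·P₁ ∈ E⁽ʲ⁺¹⁾(ℚ_p) ∖ E⁽ʲ⁺²⁾(ℚ_p)` (ONE formal-group evaluation): the `p`-strict Selmer group has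
`p^j · #Ш(E/ℚ)[p^∞]` elements (`Nat.card`). Inputs: `natCard_strictSelmer_rat_eq_of_padic_level`,
`exists_pow_smul_eq_iff_reductionPointCount_nsmul_mem_formalFiltration` (AEC IV.6.4 (b) / VII.2.1), `E(ℚ_p)[p] = 0`.
[cite: Kim2022StructureSelmer, §5.1 eq. (5.1) and Lemma 5.1] -/
theorem natCard_strictSelmer_rat_eq_of_formalLevel (hp2 : p ≠ 2) (hpv : (p : 𝓞 ℚ) ∈ v.asIdeal)
    (hgood : ¬ (p : ℤ) ∣ minimalDiscriminantInt W) (hna : ¬ p ∣ W.reductionPointCount p)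
    {P₁ : W.toAffine.Point} (hP₁ : ¬ IsOfFinAddOrder P₁)
    (hgen : ∀ Q : W.toAffine.Point, ∃ n : ℤ, IsOfFinAddOrder (Q - n • P₁)) {j : ℕ}
    (hj : W.reductionPointCount p • Affine.Point.map (W' := W) (Algebra.ofId ℚ ℚ_[p]) P₁ ∈
      (W.baseChange ℚ_[p]).formalFiltration (j + 1))
    (hj1 : W.reductionPointCount p • Affine.Point.map (W' := W) (Algebra.ofId ℚ ℚ_[p]) P₁ ∉
      (W.baseChange ℚ_[p]).formalFiltration (j + 2)) :
    Nat.card ↥(W.selmerGroupPInfty p ⊓ selmerLocalKerPrimaryTorsion W (v.adicCompletion ℚ) p) =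
      p ^ j * Nat.card (AddCommGroup.primaryComponent W.sha p) := by
  have htf := forall_nsmul_eq_zero_padic_of_not_dvd_reductionPointCount W hp2 hgood hna
  set X := Affine.Point.map (W' := W) (Algebra.ofId ℚ ℚ_[p]) P₁ with hXdef
  refine natCard_strictSelmer_rat_eq_of_padic_level W hpv hP₁ hgen ?_ ?_
  · rw [exists_eq_pow_smul_add_torsion_iff_of_forall hp.out htf]
    obtain ⟨Q, hQ⟩ := (exists_pow_smul_eq_iff_reductionPointCount_nsmul_mem_formalFiltration W p hp2
      hgood hna X j).mpr hj
    exact ⟨Q, hQ.symm⟩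
  · rw [exists_eq_pow_smul_add_torsion_iff_of_forall hp.out htf]
    rintro ⟨Q, hQ⟩
    exact hj1 ((exists_pow_smul_eq_iff_reductionPointCount_nsmul_mem_formalFiltration W p hp2 hgood hna
      X (j + 1)).mp ⟨Q, hQ.symm⟩)

end FormalLevel

end Summit.BirchSwinnertonDyer.Rank1Residual.Ordinary

end
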